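import Mathlib
import HarnessLib
import Summits.HubbardSuperconductivity.HubbardSuperconductivity.Theorems.KLProgrammeKLRegimeCountertermJacksonMixedBernstein
import Summits.HubbardSuperconductivity.HubbardSuperconductivity.Theorems.KLProgrammeKLRegimeCountertermJacksonKernelL1
import Summits.HubbardSuperconductivity.HubbardSuperconductivity.Theorems.KLProgrammeKLRegimeSplitTwoLegSizesMSQ

/-!
# Route `KLProgramme`, crux K3 — (E3a-MS) supplier: the LOW PARTS' `C³/C⁴` sizes by the MIXED Jackson–Bernstein bound, and the discharge of the
# low-part totals `Λ₃, Λ₄` (MS-A34-ter (K3); k3c3-p1 g4)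

Seat hubbard-kl-k3c3-p1 (g4).  The low part of a piece `P` is `lowPart d P = 2𝒥_d P° − 𝒥_d(𝒥_d P°)` (`P° = P − P(0)`).  With the abstract mixed bound
`norm_iteratedFDeriv_convInt_le` (`…JacksonMixedBernstein`), the kernel table `∫|J̃_d^{(a)}| ≤ 4π⁴(d+1)^a` (`…JacksonKernelL1`) and the first partials
of `P°` (bounded by the piece's gradient size `a 1`):

* `norm_iteratedFDeriv_jsmooth_anchor_le` — `‖Dʲ(𝒥_d P° ∘ ofLp)‖ ≤ 2ʲ·16π⁸(d+1)^{j−1}·a 1`, `1 ≤ j ≤ 4`; the same for `𝒥_d(𝒥_d P°)`;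
* **`norm_iteratedFDeriv_evalM_lowPart_le_mixed`** — `‖Dʲ evalM (lowPart d P)‖ ≤ 3·2ʲ·16π⁸·(d+1)^{j−1}·a 1` (`1 ≤ j ≤ 4`): ONE factor of the
  gradient size, `j − 1` factors of the degree — the shape MS-A34-ter requires (the sup-Bernstein form `24(2d+1)(1+4d)ʲ·a 0` is d-lossy);
* `msLam R U d n₀ j := 3·2ʲ·16π⁸·(d+1)^{j−1}·Gfr₁U²·(4^{n₀})⁻¹/3` and **`sum_norm_iteratedFDeriv_lowPart_le_msLam`**: the low-part totals of the
  deep pieces `Σ_{m ∈ Ioc n₀ N} ‖Dʲ evalM (lowPart d (Kp m)) q‖ ≤ msLam R U d n₀ j` — the hypotheses `hΛ₃`, `hΛ₄` of `…MSWithPiecesL` / `…MSQ`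
  DISCHARGED (`Λ_j := msLam … j`; at `d = 4^{n₀}`: `Λ₄ ≍ Gfr₁U²16^{n₀}`, `Λ₃ ≍ Gfr₁U²4^{n₀}`);
* **`twoLegSizesMSTQ_succ_of_pieces_mixed`**, **`twoLegSizesMSTQ_zero_of_pieces_mixed`** — the gen-6 (E3a-MS-TQ) suppliers with NO low-part
  hypothesis left: binders = regime + pieces + engine exports + the two fits on `msPieceBaseL … (msLam … 3) (msLam … 4)` / `msPieceSlotL …`.

Proofs only; nothing about the model.
-/

noncomputable section

namespace Summit.HubbardSuperconductivity.HubbardSuperconductivity.Theorems.KLRegimeSplit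

set_option linter.dupNamespace false -- summit = problem name (single-conjunct summit), D-0017
set_option maxSynthPendingDepth 4 -- nested operator-norm instances (symbol sizes up to order five), as in `…CompDiff`

open Real Finset MeasureTheory intervalIntegral Literature.MathematicalPhysics.QuantumLattice Literature.MathematicalPhysics.QuantumLattice.FermiRG
open Literature.MathematicalPhysics.QuantumLattice.BandSectorCounting
open Summit.HubbardSuperconductivity.HubbardSuperconductivity.Theorems.KLProgrammeLegKernels
open Summit.HubbardSuperconductivity.HubbardSuperconductivity.Theorems.DispersionFlow
open Summit.HubbardSuperconductivity.HubbardSuperconductivity.Theorems.PerturbedFermiCurve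

/-! ## §0 Continuity of the convolution form -/

/-- The convolution form is continuous in the point. -/
theorem continuous_convInt {φ ψ : ℝ → ℝ} {h : (Fin 2 → ℝ) → ℝ} (hφ : Continuous φ) (hψ : Continuous ψ) (hh : Continuous h) :
    Continuous (convInt φ ψ h) := by
  have hI : Continuous fun p : ℝ × ℝ => ∫ s in (-π)..π, φ (p.1 - s) * ∫ t in (-π)..π, ψ (p.2 - t) * h ![s, t] := by
    refine intervalIntegral.continuous_parametric_intervalIntegral_of_continuous' ?_ _ _
    exact (hφ.comp ((continuous_fst.comp continuous_fst).sub continuous_snd)).mul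
      ((continuous_inner_conv hψ hh).comp ((continuous_snd.comp continuous_fst).prodMk continuous_snd))
  have hcoord : Continuous fun y : EuclideanSpace ℝ (Fin 2) => ((y 0 : ℝ), (y 1 : ℝ)) :=
    ((PiLp.continuous_apply 2 _ 0)).prodMk (PiLp.continuous_apply 2 _ 1)
  exact hI.comp hcoord

/-! ## §1 First partials of a frame read on `Fin 2 → ℝ` -/

section Partials

variable (P : TrigPolyC4v)

/-- The first partial of `P.eval` in coordinate `i`, as a function on `Fin 2 → ℝ`. -/
def framePartial (i : Fin 2) (p : Fin 2 → ℝ) : ℝ := fderiv ℝ (evalM P) (WithLp.toLp 2 p) (eucl i)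

/-- The coordinate path `u ↦ (u, t)` in `EuclideanSpace`. -/
theorem toLp_vec_fst (u t : ℝ) : (WithLp.toLp 2 ![u, t] : EuclideanSpace ℝ (Fin 2)) = u • eucl 0 + WithLp.toLp 2 ![0, t] := by
  ext i; fin_cases i <;> simp [eucl]

/-- The coordinate path `u ↦ (s, u)` in `EuclideanSpace`. -/
theorem toLp_vec_snd (s u : ℝ) : (WithLp.toLp 2 ![s, u] : EuclideanSpace ℝ (Fin 2)) = u • eucl 1 + WithLp.toLp 2 ![s, 0] := by
  ext i; fin_cases i <;> simp [eucl]

/-- `∂₀` of the anchored piece along the first coordinate. -/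
theorem hasDerivAt_anchor_fst (s t : ℝ) :
    HasDerivAt (fun u => (msAnchor P).eval ![u, t]) (framePartial P 0 ![s, t]) s := by
  have hfun : (fun u => (msAnchor P).eval ![u, t]) = fun u => evalM P (u • eucl 0 + WithLp.toLp 2 ![0, t]) - P.eval 0 := by
    funext u; rw [eval_msAnchor, ← toLp_vec_fst]; simp [evalM]
  rw [hfun]
  have hpath : HasDerivAt (fun u : ℝ => u • eucl 0 + WithLp.toLp 2 ![0, t]) (eucl 0) s := by
    simpa using ((hasDerivAt_id s).smul_const (eucl 0)).add_const (WithLp.toLp 2 ![0, t])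
  have hd : DifferentiableAt ℝ (evalM P) (s • eucl 0 + WithLp.toLp 2 ![0, t]) := (contDiff_evalM P (k := 1)).differentiable one_ne_zero _
  have h := (hd.hasFDerivAt.comp_hasDerivAt s hpath).sub_const (P.eval 0)
  rw [← toLp_vec_fst s t] at h
  unfold framePartial
  simpa [Function.comp_def] using h

/-- `∂₁` of the anchored piece along the second coordinate. -/
theorem hasDerivAt_anchor_snd (s t : ℝ) :
    HasDerivAt (fun u => (msAnchor P).eval ![s, u]) (framePartial P 1 ![s, t]) t := by
  have hfun : (fun u => (msAnchor P).eval ![s, u]) = fun u => evalM P (u • eucl 1 + WithLp.toLp 2 ![s, 0]) - P.eval 0 := by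
    funext u; rw [eval_msAnchor, ← toLp_vec_snd]; simp [evalM]
  rw [hfun]
  have hpath : HasDerivAt (fun u : ℝ => u • eucl 1 + WithLp.toLp 2 ![s, 0]) (eucl 1) t := by
    simpa using ((hasDerivAt_id t).smul_const (eucl 1)).add_const (WithLp.toLp 2 ![s, 0])
  have hd : DifferentiableAt ℝ (evalM P) (t • eucl 1 + WithLp.toLp 2 ![s, 0]) := (contDiff_evalM P (k := 1)).differentiable one_ne_zero _
  have h := (hd.hasFDerivAt.comp_hasDerivAt t hpath).sub_const (P.eval 0)
  rw [← toLp_vec_snd s t] at h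
  unfold framePartial
  simpa [Function.comp_def] using h

/-- The partials are continuous. -/
theorem continuous_framePartial (i : Fin 2) : Continuous (framePartial P i) := by
  unfold framePartial
  exact (((contDiff_evalM P (k := 1)).continuous_fderiv one_ne_zero).comp (PiLp.continuous_toLp 2 _)).clm_apply continuous_const

/-- The partials are bounded by the gradient size. -/
theorem abs_framePartial_le {a : ℕ → ℝ} (ha : ∀ j ≤ 4, ∀ q : Momentum, ‖iteratedFDeriv ℝ j (evalM P) q‖ ≤ a j) (i : Fin 2) (p : Fin 2 → ℝ) :
    |framePartial P i p| ≤ a 1 := by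
  unfold framePartial
  have h1 := ha 1 (by norm_num) (WithLp.toLp 2 p)
  rw [← norm_fderiv_eq_norm_iteratedFDeriv_one] at h1
  have he : ‖eucl i‖ = 1 := by simp [eucl]
  rw [← Real.norm_eq_abs]
  calc ‖fderiv ℝ (evalM P) (WithLp.toLp 2 p) (eucl i)‖ ≤ ‖fderiv ℝ (evalM P) (WithLp.toLp 2 p)‖ * ‖eucl i‖ :=
        ContinuousLinearMap.le_opNorm _ _
    _ ≤ a 1 := by rw [he, mul_one]; exact h1

end Partials

/-! ## §2 The mixed bound for `𝒥_d P°` and `𝒥_d(𝒥_d P°)` -/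

section Mixed

variable (d : ℕ) {P : TrigPolyC4v} {a : ℕ → ℝ}
  (ha : ∀ j ≤ 4, ∀ q : Momentum, ‖iteratedFDeriv ℝ j (evalM P) q‖ ≤ a j)

/-- The kernel product table instantiated: `Λ_n = 16π⁸(d+1)^{n−1}`. -/
theorem jkerD_table (d : ℕ) {n : ℕ} (hn : n ≤ 4) :
    ∀ a' b, a' + b + 1 = n → (∫ s in (-π)..π, |jkerD d a' s|) * (∫ s in (-π)..π, |jkerD d b s|) ≤ 16 * π ^ 8 * ((d : ℝ) + 1) ^ (n - 1) := by
  intro a' b hab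
  have h := integral_abs_jkerD_mul_le d (a := a') (b := b) (by omega) (by omega)
  rwa [show a' + b = n - 1 by omega] at h

/-- **Mixed bound for a convolution `convInt J̃ J̃ h` with `h` lattice-periodic, partials bounded by `a 1`, of class `C⁴`.** -/
theorem norm_iteratedFDeriv_convInt_jker_le {h h₀ h₁ : (Fin 2 → ℝ) → ℝ} (hh : Continuous h)
    (hper : ∀ (p : Fin 2 → ℝ) (z : Fin 2 → ℤ), h (fun i => p i + z i * (2 * π)) = h p)
    (hJ : ContDiff ℝ 4 (convInt (jkerD d 0) (jkerD d 0) h)) (hh₀ : Continuous h₀) (hh₁ : Continuous h₁)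
    (hder₀ : ∀ s t, HasDerivAt (fun u => h ![u, t]) (h₀ ![s, t]) s) (hder₁ : ∀ s t, HasDerivAt (fun u => h ![s, u]) (h₁ ![s, t]) t)
    (hB₀ : ∀ p, |h₀ p| ≤ a 1) (hB₁ : ∀ p, |h₁ p| ≤ a 1) {j : ℕ} (hj1 : 1 ≤ j) (hj : j ≤ 4) (y : EuclideanSpace ℝ (Fin 2)) :
    ‖iteratedFDeriv ℝ j (convInt (jkerD d 0) (jkerD d 0) h) y‖ ≤ 2 ^ j * (16 * π ^ 8 * ((d : ℝ) + 1) ^ (j - 1) * a 1) :=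
  norm_iteratedFDeriv_convInt_le (hasDerivAt_jkerD d) (continuous_jkerD d) (jkerD_periodic d) hh hper hJ hh₀ hh₁ hder₀ hder₁ hB₀ hB₁
    hj1 hj (jkerD_table d hj) y

/-- `𝒥_d F ∘ ofLp = convInt J̃ J̃ F` as functions. -/
theorem jsmooth_onM_eq_convInt {F : (Fin 2 → ℝ) → ℝ} (hper : ∀ (p : Fin 2 → ℝ) (z : Fin 2 → ℤ), F (fun i => p i + z i * (2 * π)) = F p) :
    (fun q : EuclideanSpace ℝ (Fin 2) => jsmooth d F (WithLp.ofLp q)) = convInt (jkerD d 0) (jkerD d 0) F :=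
  funext fun q => by rw [jkerD_zero]; exact jsmooth_eq_convInt d hper q

/-- **The partial of `𝒥_d h` along the first coordinate is `𝒥_d h₀`.** -/
theorem hasDerivAt_jsmooth_fst {h h₀ : (Fin 2 → ℝ) → ℝ} (hh : Continuous h) (hh₀ : Continuous h₀)
    (hper : ∀ (p : Fin 2 → ℝ) (z : Fin 2 → ℤ), h (fun i => p i + z i * (2 * π)) = h p)
    (hder₀ : ∀ s t, HasDerivAt (fun u => h ![u, t]) (h₀ ![s, t]) s) (s t : ℝ) :
    HasDerivAt (fun u => jsmooth d h ![u, t]) (convInt (jkerD d 0) (jkerD d 0) h₀ (WithLp.toLp 2 ![s, t])) s := by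
  set y : EuclideanSpace ℝ (Fin 2) := WithLp.toLp 2 ![s, t] with hy
  have hfun : (fun u => jsmooth d h ![u, t]) = fun u => convInt (jkerD d 0) (jkerD d 0) h (y + (u - s) • eucl 0) := by
    funext u
    have e : (WithLp.toLp 2 ![u, t] : EuclideanSpace ℝ (Fin 2)) = y + (u - s) • eucl 0 := by
      ext i; fin_cases i <;> simp [hy, eucl]
    rw [← e, jkerD_zero, ← jsmooth_eq_convInt d hper]
  rw [hfun]
  have h1 := hasDerivAt_convInt_fst (ψ := jkerD d 0) (h := h) (hasDerivAt_jkerD d 0) (continuous_jkerD d 0) (continuous_jkerD d 1)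
    (continuous_jkerD d 0) hh y
  have h2 : HasDerivAt (fun u : ℝ => u - s) 1 s := (hasDerivAt_id s).sub_const s
  have h3 := h1.comp_of_eq s h2 (by simp)
  rw [convInt_deriv_fst (ψ := jkerD d 0) (hasDerivAt_jkerD d 0) (continuous_jkerD d 1) (jkerD_periodic d 0) (continuous_jkerD d 0) hh hh₀
    hder₀ hper y] at h3
  simpa [Function.comp_def] using h3

/-- **The partial of `𝒥_d h` along the second coordinate is `𝒥_d h₁`.** -/
theorem hasDerivAt_jsmooth_snd {h h₁ : (Fin 2 → ℝ) → ℝ} (hh : Continuous h) (hh₁ : Continuous h₁)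
    (hper : ∀ (p : Fin 2 → ℝ) (z : Fin 2 → ℤ), h (fun i => p i + z i * (2 * π)) = h p)
    (hder₁ : ∀ s t, HasDerivAt (fun u => h ![s, u]) (h₁ ![s, t]) t) (s t : ℝ) :
    HasDerivAt (fun u => jsmooth d h ![s, u]) (convInt (jkerD d 0) (jkerD d 0) h₁ (WithLp.toLp 2 ![s, t])) t := by
  set y : EuclideanSpace ℝ (Fin 2) := WithLp.toLp 2 ![s, t] with hy
  have hfun : (fun u => jsmooth d h ![s, u]) = fun u => convInt (jkerD d 0) (jkerD d 0) h (y + (u - t) • eucl 1) := by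
    funext u
    have e : (WithLp.toLp 2 ![s, u] : EuclideanSpace ℝ (Fin 2)) = y + (u - t) • eucl 1 := by
      ext i; fin_cases i <;> simp [hy, eucl]
    rw [← e, jkerD_zero, ← jsmooth_eq_convInt d hper]
  rw [hfun]
  have h1 := hasDerivAt_convInt_snd (φ := jkerD d 0) (h := h) (hasDerivAt_jkerD d 0) (continuous_jkerD d 0) (continuous_jkerD d 1)
    (continuous_jkerD d 0) hh y
  have h2 : HasDerivAt (fun u : ℝ => u - t) 1 t := (hasDerivAt_id t).sub_const t
  have h3 := h1.comp_of_eq t h2 (by simp)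
  rw [convInt_deriv_snd (φ := jkerD d 0) (hasDerivAt_jkerD d 0) (continuous_jkerD d 1) (jkerD_periodic d 0) hh₁ hder₁ hper y] at h3
  simpa [Function.comp_def] using h3

include ha in
/-- **`‖Dʲ evalM (lowPart d P)‖ ≤ 3·2ʲ·16π⁸(d+1)^{j−1}·a 1`** for `1 ≤ j ≤ 4` — the MIXED Jackson–Bernstein size of the low part. -/
theorem norm_iteratedFDeriv_evalM_lowPart_le_mixed {j : ℕ} (hj1 : 1 ≤ j) (hj : j ≤ 4) (q : Momentum) :
    ‖iteratedFDeriv ℝ j (evalM (lowPart d P)) q‖ ≤ 3 * (2 ^ j * (16 * π ^ 8 * ((d : ℝ) + 1) ^ (j - 1) * a 1)) := by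
  set g : (Fin 2 → ℝ) → ℝ := (msAnchor P).eval with hgdef
  have hs := isSymmetricFrame_eval (msAnchor P)
  have hper : ∀ (p : Fin 2 → ℝ) (z : Fin 2 → ℤ), g (fun i => p i + z i * (2 * π)) = g p := hs.1
  have hgc : Continuous g := continuous_trigPoly_eval _
  -- the two smoothing packages (ContDiff + bounds)
  obtain ⟨hPc, hPC, hPb, _⟩ := jsmooth_package d hgc (m := 4) (contDiff_onM_msAnchor P) (B := anchorSize a)
    (fun i hi x => norm_iteratedFDeriv_onM_msAnchor_le ha hi x)
  obtain ⟨_, hPPC, _, _⟩ := jsmooth_package d hPc (m := 4) hPC (B := anchorSize a) hPb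
  -- partials of `g` and of `𝒥 g`
  have hper' : ∀ (p : Fin 2 → ℝ) (z : Fin 2 → ℤ), jsmooth d g (fun i => p i + z i * (2 * π)) = jsmooth d g p := jsmooth_periodic d hper
  have hB₀ := abs_framePartial_le P ha 0
  have hB₁ := abs_framePartial_le P ha 1
  have hJ : ContDiff ℝ 4 (convInt (jkerD d 0) (jkerD d 0) g) := by rw [← jsmooth_onM_eq_convInt d hper]; exact hPC
  have hJ' : ContDiff ℝ 4 (convInt (jkerD d 0) (jkerD d 0) (jsmooth d g)) := by rw [← jsmooth_onM_eq_convInt d hper']; exact hPPC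
  -- partials of `𝒥 g`: `𝒥 g₀`, `𝒥 g₁` (continuous, bounded by `a 1` since the kernel has mass one)
  have hmass : ∫ s in (-π)..π, |jkerD d 0 s| = 1 := integral_abs_jkerD_zero d
  have hGc : ∀ i, Continuous fun p : Fin 2 → ℝ => convInt (jkerD d 0) (jkerD d 0) (framePartial P i) (WithLp.toLp 2 p) := fun i =>
    (continuous_convInt (continuous_jkerD d 0) (continuous_jkerD d 0) (continuous_framePartial P i)).comp (PiLp.continuous_toLp 2 _)
  have hGb : ∀ i (p : Fin 2 → ℝ), |convInt (jkerD d 0) (jkerD d 0) (framePartial P i) (WithLp.toLp 2 p)| ≤ a 1 := fun i p => by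
    have h := abs_convInt_le (continuous_jkerD d 0) (continuous_jkerD d 0) (jkerD_periodic d 0) (jkerD_periodic d 0)
      (continuous_framePartial P i) (abs_framePartial_le P ha i) (WithLp.toLp 2 p)
    rw [hmass, one_mul, one_mul] at h; exact h
  -- the two mixed bounds
  have hM1 := norm_iteratedFDeriv_convInt_jker_le d hgc hper hJ (continuous_framePartial P 0) (continuous_framePartial P 1)
    (hasDerivAt_anchor_fst P) (hasDerivAt_anchor_snd P) hB₀ hB₁ hj1 hj q
  have hM2 := norm_iteratedFDeriv_convInt_jker_le d (continuous_jsmooth d hgc) hper' hJ' (hGc 0) (hGc 1)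
    (fun s t => hasDerivAt_jsmooth_fst d hgc (continuous_framePartial P 0) hper (hasDerivAt_anchor_fst P) s t)
    (fun s t => hasDerivAt_jsmooth_snd d hgc (continuous_framePartial P 1) hper (hasDerivAt_anchor_snd P) s t) (hGb 0) (hGb 1) hj1 hj q
  -- the low part is `2𝒥g − 𝒥(𝒥g)`
  have hfun : evalM (lowPart d P) = (fun q => (2 : ℝ) • convInt (jkerD d 0) (jkerD d 0) g q) - convInt (jkerD d 0) (jkerD d 0) (jsmooth d g) := by
    rw [← jsmooth_onM_eq_convInt d hper, ← jsmooth_onM_eq_convInt d hper']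
    funext q; simp [evalM, eval_lowPart, jlow, hgdef, smul_eq_mul]
  rw [hfun, iteratedFDeriv_sub_apply ((hJ.of_le (by exact_mod_cast hj)).const_smul (2 : ℝ)).contDiffAt (hJ'.of_le (by exact_mod_cast hj)).contDiffAt,
    iteratedFDeriv_const_smul_apply' (hJ.of_le (by exact_mod_cast hj)).contDiffAt]
  calc ‖(2 : ℝ) • iteratedFDeriv ℝ j (convInt (jkerD d 0) (jkerD d 0) g) q - iteratedFDeriv ℝ j (convInt (jkerD d 0) (jkerD d 0) (jsmooth d g)) q‖
      ≤ ‖(2 : ℝ) • iteratedFDeriv ℝ j (convInt (jkerD d 0) (jkerD d 0) g) q‖ + ‖iteratedFDeriv ℝ j (convInt (jkerD d 0) (jkerD d 0) (jsmooth d g)) q‖ :=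
        norm_sub_le _ _
    _ ≤ 2 * (2 ^ j * (16 * π ^ 8 * ((d : ℝ) + 1) ^ (j - 1) * a 1)) + 2 ^ j * (16 * π ^ 8 * ((d : ℝ) + 1) ^ (j - 1) * a 1) := by
        rw [norm_smul, Real.norm_eq_abs, abs_two]; exact add_le_add (mul_le_mul_of_nonneg_left hM1 (by norm_num)) hM2
    _ = 3 * (2 ^ j * (16 * π ^ 8 * ((d : ℝ) + 1) ^ (j - 1) * a 1)) := by ring

end Mixed

/-! ## §3 The low-part totals of the deep pieces and the suppliers with `Λ` discharged -/

/-- **The low-part total budget** at order `j` (scale `n₀`, Jackson degree `d`): `3·2ʲ·16π⁸·(d+1)^{j−1}·Gfr₁U²·(4^{n₀})⁻¹/3`. -/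
def msLam (R : RenConsts) (U : ℝ) (d n₀ j : ℕ) : ℝ :=
  3 * (2 ^ j * (16 * π ^ 8 * ((d : ℝ) + 1) ^ (j - 1))) * (R.Gfr 1 * U ^ 2 * (((4 : ℝ) ^ n₀)⁻¹ / 3))

/-- The geometric tail `Σ_{m ∈ Ioc n N} 4^{−m} ≤ 4^{−n}/3`. [folklore] -/
theorem sum_Ioc_four_inv_le (n N : ℕ) : ∑ m ∈ Ioc n N, ((4 : ℝ) ^ m)⁻¹ ≤ ((4 : ℝ) ^ n)⁻¹ / 3 := by
  have key : ∀ N, n ≤ N → ∑ m ∈ Ioc n N, ((4 : ℝ) ^ m)⁻¹ = (((4 : ℝ) ^ n)⁻¹ - ((4 : ℝ) ^ N)⁻¹) / 3 := by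
    intro N hN
    induction N with
    | zero =>
      have hn0 : n = 0 := by omega
      subst hn0; simp
    | succ N ih =>
      rcases Nat.eq_or_lt_of_le hN with h | h
      · subst h; simp
      · rw [Finset.sum_Ioc_succ_top (by omega), ih (by omega), pow_succ, mul_inv]
        have : ((4 : ℝ) ^ N)⁻¹ = 4 * (((4 : ℝ) ^ N)⁻¹ * (4 : ℝ)⁻¹) := by field_simp
        rw [this]; ring
  by_cases hN : n ≤ N
  · rw [key N hN]
    have : 0 ≤ ((4 : ℝ) ^ N)⁻¹ := by positivity
    linarith
  · rw [Finset.Ioc_eq_empty (by omega), Finset.sum_empty]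
    positivity

/-- The order-1 piece size is `Gfr₁U²·4^{−m}` (inverse form; cf. `pieceSize_one_eq` of `…MSFitPiecesAux`). -/
theorem pieceSize_one_eq_inv (R : RenConsts) (U : ℝ) (m : ℕ) : pieceSize R U m 1 = R.Gfr 1 * U ^ 2 * ((4 : ℝ) ^ m)⁻¹ := by
  unfold pieceSize uPow
  rw [if_neg one_ne_zero, show (((1 : ℕ) : ℤ) - 2) * (m : ℤ) = -((m : ℕ) : ℤ) by push_cast; ring, zpow_neg, zpow_natCast]

/-- **THE LOW-PART TOTALS OF THE DEEP PIECES** (`1 ≤ j ≤ 4`): `Σ_{m ∈ Ioc n₀ N} ‖Dʲ evalM (lowPart d (Kp m)) q‖ ≤ msLam R U d n₀ j` — the hypotheses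
`hΛ₃`, `hΛ₄` of `…MSWithPiecesL` discharged by the mixed Jackson–Bernstein bound. -/
theorem sum_norm_iteratedFDeriv_lowPart_le_msLam (d : ℕ) {R : RenConsts} (hR : ∀ j, 0 ≤ R.Gfr j) {U : ℝ} {Kp : ℕ → TrigPolyC4v} {n₀ N : ℕ}
    (ha : ∀ m ≤ N, ∀ j ≤ 4, ∀ q : Momentum, ‖iteratedFDeriv ℝ j (evalM (Kp m)) q‖ ≤ pieceSize R U m j)
    {j : ℕ} (hj1 : 1 ≤ j) (hj : j ≤ 4) (q : Momentum) :
    ∑ m ∈ Ioc n₀ N, ‖iteratedFDeriv ℝ j (evalM (lowPart d (Kp m))) q‖ ≤ msLam R U d n₀ j := by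
  have hC : 0 ≤ 3 * (2 ^ j * (16 * π ^ 8 * ((d : ℝ) + 1) ^ (j - 1))) := by positivity
  have h1 := hR 1
  calc ∑ m ∈ Ioc n₀ N, ‖iteratedFDeriv ℝ j (evalM (lowPart d (Kp m))) q‖
      ≤ ∑ m ∈ Ioc n₀ N, 3 * (2 ^ j * (16 * π ^ 8 * ((d : ℝ) + 1) ^ (j - 1))) * (R.Gfr 1 * U ^ 2 * ((4 : ℝ) ^ m)⁻¹) :=
        Finset.sum_le_sum fun m hm => by
          have h := norm_iteratedFDeriv_evalM_lowPart_le_mixed d (ha m (Finset.mem_Ioc.mp hm).2) hj1 hj q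
          rw [pieceSize_one_eq_inv] at h
          linarith
    _ = 3 * (2 ^ j * (16 * π ^ 8 * ((d : ℝ) + 1) ^ (j - 1))) * (R.Gfr 1 * U ^ 2 * ∑ m ∈ Ioc n₀ N, ((4 : ℝ) ^ m)⁻¹) := by
        rw [Finset.mul_sum, Finset.mul_sum]
    _ ≤ msLam R U d n₀ j := by
        unfold msLam
        exact mul_le_mul_of_nonneg_left (mul_le_mul_of_nonneg_left (sum_Ioc_four_inv_le n₀ N) (mul_nonneg h1 (sq_nonneg U))) hC

section MS

variable {L M : ℕ} [NeZero L] [NeZero M] {G : GeoConsts} {Q : EngConsts} {R : RenConsts} {β U μ : ℝ}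

/-- **(E3a-MS-TQ) AT SCALE `n+1`, NO LOW-PART HYPOTHESIS LEFT**: `twoLegSizesMSTQ_succ_of_pieces` with `Λ₃ := msLam R U d (n+1) 3`,
`Λ₄ := msLam R U d (n+1) 4` discharged by `sum_norm_iteratedFDeriv_lowPart_le_msLam`. -/
theorem twoLegSizesMSTQ_succ_of_pieces_mixed (hR : ∀ j, 0 ≤ R.Gfr j) {c : ℝ} (hc : 0 < c) (hcle : c ≤ klCurveC3 R / 16)
    (hU : 0 < U) (hUle : U ≤ klCurveU0 R / 16) (hβmin : klBetaMin ≤ β) (hβc : β ≤ Real.exp (c / U ^ 2)) (hμ : μ ∈ klWindowC)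
    {K : TrigPolyC4v} {Kp : ℕ → TrigPolyC4v} (hK : ∀ p : Fin 2 → ℝ, K.eval p = ∑ m ∈ range (nScales β + 1), (Kp m).eval p)
    (ha : ∀ m ≤ nScales β, ∀ j ≤ 4, ∀ q : Momentum, ‖iteratedFDeriv ℝ j (evalM (Kp m)) q‖ ≤ pieceSize R U m j)
    {n : ℕ} (hn : n + 1 ≤ nScales β) (d : ℕ)
    (hc₁ : Continuous (klLocalPart L M β U μ K (n + 1))) (hc₀ : Continuous (klLocalPart L M β U μ K n))
    {S : ℕ → TrigPolyC4v}
    (hS : ∀ θ, klLocalPart L M β U μ K (n + 1) θ - klLocalPart L M β U μ K n θ =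
      (S (nScales β - (n + 1))).eval (klFermiPoint μ K θ))
    {σ : ℕ → ℕ → ℝ} (hσnn : ∀ k l, 0 ≤ σ k l)
    (hσ0 : ∀ k ≤ nScales β - (n + 1), ∀ q : Momentum, |evalM (S k) q| ≤ σ k 0)
    (hσ : ∀ k ≤ nScales β - (n + 1), ∀ l, 1 ≤ l → l ≤ 5 → ∀ q : Momentum, ‖iteratedFDeriv ℝ l (evalM (S k)) q‖ ≤ σ k l)
    {ε : ℕ → ℕ → ℝ} (hεnn : ∀ m l, 0 ≤ ε m l)
    (hε0 : ∀ m ∈ Ioc (n + 1) (nScales β), ∀ q : Momentum, |evalM (fsub (S (m - (n + 1))) (S (m - (n + 1) - 1))) q| ≤ ε m 0)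
    (hε : ∀ m ∈ Ioc (n + 1) (nScales β), ∀ l, 1 ≤ l → l ≤ 4 → ∀ q : Momentum,
      ‖iteratedFDeriv ℝ l (evalM (fsub (S (m - (n + 1))) (S (m - (n + 1) - 1)))) q‖ ≤ ε m l)
    {X : ℝ} (hX : ∀ l ≤ 4, ∀ x : ℝ, ‖iteratedFDeriv ℝ l salmhoferCutoff x‖ ≤ X)
    (hfit_n : ∀ j ≤ 4, msPieceBaseL X σ R U (n + 1) (msLam R U d (n + 1) 3) (msLam R U d (n + 1) 4) j ≤ twoLegBar G Q U j (n + 1))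
    (hfit_m : ∀ m ∈ Ioc (n + 1) (nScales β), ∀ j ≤ 4,
      msPieceSlotL X σ ε R c U d (n + 1) (msLam R U d (n + 1) 3) (msLam R U d (n + 1) 4) m j ≤
        msBarQ G Q U (n + 1) * (R.Gfr j * uPow j U * (4 : ℝ) ^ (((j : ℤ) - 2) * m))) :
    TwoLegSizesMSTQ L M G Q R β U μ K (n + 1) :=
  twoLegSizesMSTQ_succ_of_pieces hR hc hcle hU hUle hβmin hβc hμ hK ha hn d
    (fun q => sum_norm_iteratedFDeriv_lowPart_le_msLam d hR ha (by norm_num) (by norm_num) q)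
    (fun q => sum_norm_iteratedFDeriv_lowPart_le_msLam d hR ha (by norm_num) le_rfl q)
    hc₁ hc₀ hS hσnn hσ0 hσ hεnn hε0 hε hX hfit_n hfit_m

/-- **(E3a-MS-TQ) AT SCALE `0`, NO LOW-PART HYPOTHESIS LEFT.** -/
theorem twoLegSizesMSTQ_zero_of_pieces_mixed (hR : ∀ j, 0 ≤ R.Gfr j) {c : ℝ} (hc : 0 < c) (hcle : c ≤ klCurveC3 R / 16)
    (hU : 0 < U) (hUle : U ≤ klCurveU0 R / 16) (hβmin : klBetaMin ≤ β) (hβc : β ≤ Real.exp (c / U ^ 2)) (hμ : μ ∈ klWindowC)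
    {K : TrigPolyC4v} {Kp : ℕ → TrigPolyC4v} (hK : ∀ p : Fin 2 → ℝ, K.eval p = ∑ m ∈ range (nScales β + 1), (Kp m).eval p)
    (ha : ∀ m ≤ nScales β, ∀ j ≤ 4, ∀ q : Momentum, ‖iteratedFDeriv ℝ j (evalM (Kp m)) q‖ ≤ pieceSize R U m j)
    (d : ℕ) (hc₀ : Continuous (klLocalPart L M β U μ K 0))
    {S : ℕ → TrigPolyC4v}
    (hS : ∀ θ, klLocalPart L M β U μ K 0 θ - K.eval (klFermiPoint μ K θ) = (S (nScales β)).eval (klFermiPoint μ K θ))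
    {σ : ℕ → ℕ → ℝ} (hσnn : ∀ k l, 0 ≤ σ k l)
    (hσ0 : ∀ k ≤ nScales β, ∀ q : Momentum, |evalM (S k) q| ≤ σ k 0)
    (hσ : ∀ k ≤ nScales β, ∀ l, 1 ≤ l → l ≤ 5 → ∀ q : Momentum, ‖iteratedFDeriv ℝ l (evalM (S k)) q‖ ≤ σ k l)
    {ε : ℕ → ℕ → ℝ} (hεnn : ∀ m l, 0 ≤ ε m l)
    (hε0 : ∀ m ∈ Ioc 0 (nScales β), ∀ q : Momentum, |evalM (fsub (S m) (S (m - 1))) q| ≤ ε m 0)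
    (hε : ∀ m ∈ Ioc 0 (nScales β), ∀ l, 1 ≤ l → l ≤ 4 → ∀ q : Momentum,
      ‖iteratedFDeriv ℝ l (evalM (fsub (S m) (S (m - 1)))) q‖ ≤ ε m l)
    {X : ℝ} (hX : ∀ l ≤ 4, ∀ x : ℝ, ‖iteratedFDeriv ℝ l salmhoferCutoff x‖ ≤ X)
    (hfit_n : ∀ j ≤ 4, msPieceBaseL X σ R U 0 (msLam R U d 0 3) (msLam R U d 0 4) j ≤ twoLegBar G Q U j 0)
    (hfit_m : ∀ m ∈ Ioc 0 (nScales β), ∀ j ≤ 4,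
      msPieceSlotL X σ ε R c U d 0 (msLam R U d 0 3) (msLam R U d 0 4) m j ≤ msBarQ G Q U 0 * (R.Gfr j * uPow j U * (4 : ℝ) ^ (((j : ℤ) - 2) * m))) :
    TwoLegSizesMSTQ L M G Q R β U μ K 0 :=
  twoLegSizesMSTQ_zero_of_pieces hR hc hcle hU hUle hβmin hβc hμ hK ha d
    (fun q => sum_norm_iteratedFDeriv_lowPart_le_msLam d hR ha (by norm_num) (by norm_num) q)
    (fun q => sum_norm_iteratedFDeriv_lowPart_le_msLam d hR ha (by norm_num) le_rfl q)
    hc₀ hS hσnn hσ0 hσ hεnn hε0 hε hX hfit_n hfit_m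

end MS


end Summit.HubbardSuperconductivity.HubbardSuperconductivity.Theorems.KLRegimeSplit

end
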